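import Mathlib
import HarnessLib
import Literature.Dynamics.Hyperbolic.RGFlowStableManifoldLastScaleFunctional

/-!
# The second fixed point of the fine tuning ([ABKM19] Lemma 12.6), VII: the SIX DIFFERENCE SIZES
# of the free-energy representation — seeds and last-scale functionals of two / four tuned systems

Continuation of `RGFlowStableManifoldSecondFixedPoint{Lipschitz,SecondDiff}.lean` (regular dependence
of the tuned seed `h⋆` and of the tuned trajectory on the initial activity) and
`RGFlowStableManifoldLastScaleFunctional.lean` (differences of a last-scale functional `Φ(h, K_N)`).
In the free-energy representation of [ABKM19] Ch. 4,
`𝒵_N(𝒦) = c · κ(q(h⋆)) · e^{|Λ|λ(h⋆)} · I`, `I = Φ(h⋆, K_N)`, the `C^{1,1}`-bounds of Theorem 2.2 in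
difference form are assembled (`Summits/…/FreeEnergyPieces`) from exactly six numbers: the first
differences of the seeds `h_{1j} − h_{0j}`, `h_{i1} − h_{i0}`, their mixed second difference `Σ± h_{ij}`,
and the same three for the last-scale functionals `I_{ij} = Φ(h_{ij}, K_N^{ij})`.  This file produces all
six from the hypotheses of the fixed-point theorems plus the difference-form hypotheses on `Φ`:

* **`RGFlow.lastScale_sub_le_of_isTunedQ`** — two systems (initial activities differing by `m_p`):
  `‖h₁ − h₂‖ ≤ T` and `‖Φ(h₁, K_N¹) − Φ(h₂, K_N²)‖ ≤ (c_I + l_I ε) T η^N`, `T = 2m_p/(1−κ)`;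
* **`RGFlow.freeEnergySizes_of_isTunedQ`** — four systems (`Bool × Bool`): the three seed sizes
  `T₁ = 2μ₁/(1−κ)`, `T₂ = 2μ₂/(1−κ)`, `T₁₂ = 2·Rest/(1−κ)` and the three functional sizes
  `(c_I + l_Iε)T_iη^N`, `(c_I T₁₂ + 2l_I' T₁T₂ + (l_I T₁₂ + l_II T₁T₂)ε)η^N`.

Pure bookkeeping over parts IV–VI; everything is proved, no named fact.

## References
* S. Adams, S. Buchholz, R. Kotecký, S. Müller, arXiv:1910.13564, Ch. 4 (4.7)–(4.12), Lemma 8.4,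
  Lemma 12.6, Theorem 12.1, Theorem 2.2 [AdamsBuchholzKoteckyMuller2019].
-/

noncomputable section

open Set Function Metric Filter
open scoped NNReal Topology

namespace Literature.Dynamics.Hyperbolic

namespace RGFlow

variable {E : ℕ → Type*} [∀ k, NormedAddCommGroup (E k)] [∀ k, NormedSpace ℝ (E k)]
  {F : ℕ → Type*} [∀ k, AddCommGroup (F k)]
  {V : Type*} [NormedAddCommGroup V]

/-! ## §18 Two systems: first differences of seed and last-scale functional -/

section twoSystems

variable {N : ℕ} {r α β σ η κ ε ρ a₀ b₀ l₀ m₀ mp cI lI : ℝ} {Q : ∀ k, F k → ℝ → Prop}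
  {A : E 0 → ∀ k, E k ≃L[ℝ] E (k + 1)} {B : E 0 → ∀ k, F k →+ E (k + 1)}
  {S : E 0 → ∀ k, E k → F k → F (k + 1)} {y₀ y₀' : E 0 → F 0}
  {Φ : E 0 → F N → V} {h₁ h₂ : E 0} {x₁ x₂ : ∀ k, E k}

/-- **First differences of the seed and of the last-scale functional between two fixed points of
Lemma 12.6** ([ABKM19] Theorem 2.2, `ℓ = 1`, difference form): in the setting of
`dist_traj_le_of_isTunedQ_initial` (two systems sharing the steps, initial activities `y₀, y₀'` with
`‖y₀^h − y₀'^h‖_0 ≤ m_p`), with a last-scale functional `Φ` whose activity differences are bounded by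
`c_I` and which is `l_I‖y‖_N`-Lipschitz in the seed:
`‖h₁ − h₂‖ ≤ T` and `‖Φ(h₁, K_N¹) − Φ(h₂, K_N²)‖ ≤ (c_I + l_I ε)·T·η^N`, `T = 2m_p/(1−κ)`.
[cite: AdamsBuchholzKoteckyMuller2019, Lemma 12.6, Theorem 2.2, Ch. 4 (4.12)] -/
theorem lastScale_sub_le_of_isTunedQ (hQ : IsSubaddNormBound Q)
    (hQc : ∀ k (y : F k) (c : ℝ), (∀ c', c < c' → Q k y c') → Q k y c)
    (hT : ∀ h : E 0, ‖h‖ ≤ ρ → IsRGStepQ N r α β σ Q (A h) (B h) (S h))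
    (hη : 0 < η) (hη1 : η ≤ 1) (hα : 0 ≤ α) (hβ : 0 ≤ β) (hκ₁ : α * (η + β) ≤ κ) (hκ₂ : σ ≤ κ * η)
    (hκ : κ < 1) (hε : 0 ≤ ε) (hεr : ε ≤ r) (hερ : ε ≤ ρ) (ha0 : 0 ≤ a₀) (hb0 : 0 ≤ b₀) (hl0 : 0 ≤ l₀)
    (hmp : 0 ≤ mp)
    (ha : ∀ h h' : E 0, ‖h‖ ≤ ρ → ‖h'‖ ≤ ρ → ∀ k, k < N → ∀ w : E (k + 1),
      ‖(A h k).symm w - (A h' k).symm w‖ ≤ a₀ * ‖h - h'‖ * ‖w‖)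
    (hb : ∀ h h' : E 0, ‖h‖ ≤ ρ → ‖h'‖ ≤ ρ → ∀ k, k < N → ∀ (v : F k) (c : ℝ), Q k v c →
      ‖B h k v - B h' k v‖ ≤ b₀ * ‖h - h'‖ * c)
    (hl : ∀ h h' : E 0, ‖h‖ ≤ ρ → ‖h'‖ ≤ ρ → ∀ k, k < N → ∀ (u : E k) (v : F k) (c : ℝ),
      ‖u‖ ≤ r → Q k v c → c ≤ r → Q (k + 1) (S h k u v - S h' k u v) (l₀ * ‖h - h'‖ * max ‖u‖ c))
    (hm : ∀ h h' : E 0, ‖h‖ ≤ ρ → ‖h'‖ ≤ ρ → Q 0 (y₀ h - y₀ h') (m₀ * ‖h - h'‖))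
    (hmp' : ∀ h : E 0, ‖h‖ ≤ ρ → Q 0 (y₀ h - y₀' h) mp)
    (hsmall : max m₀ (max (l₀ * ε / η) ((α * b₀ + a₀ * (η + β + 2 * ρ * b₀)) * ε)) ≤ (1 - κ) / 2)
    (hΦ1 : ∀ h : E 0, ‖h‖ ≤ ρ → ∀ (y y' : F N) (cy cy' c : ℝ), Q N y cy → cy ≤ r → Q N y' cy' →
      cy' ≤ r → Q N (y - y') c → ‖Φ h y - Φ h y'‖ ≤ cI * c)
    (hΦ2 : ∀ h h' : E 0, ‖h‖ ≤ ρ → ‖h'‖ ≤ ρ → ∀ (y : F N) (c : ℝ), Q N y c → c ≤ r →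
      ‖Φ h y - Φ h' y‖ ≤ lI * ‖h - h'‖ * c)
    (hlI : 0 ≤ lI)
    (htr₁ : IsTunedQ N (A h₁) (B h₁) (S h₁) (y₀ h₁) x₁) (htu₁ : InTubeQ N η ε Q (S h₁) (y₀ h₁) x₁)
    (hx₁ : x₁ 0 = h₁)
    (htr₂ : IsTunedQ N (A h₂) (B h₂) (S h₂) (y₀' h₂) x₂) (htu₂ : InTubeQ N η ε Q (S h₂) (y₀' h₂) x₂)
    (hx₂ : x₂ 0 = h₂) :
    ‖h₁ - h₂‖ ≤ 2 * mp / (1 - κ) ∧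
      ‖Φ h₁ (fwd (S h₁) (y₀ h₁) x₁ N) - Φ h₂ (fwd (S h₂) (y₀' h₂) x₂ N)‖
        ≤ (cI + lI * ε) * (2 * mp / (1 - κ)) * η ^ N := by
  have hh₁ : ‖h₁‖ ≤ ρ := by
    have h := (htu₁ 0 (Nat.zero_le _)).1
    rw [pow_zero, mul_one, hx₁] at h
    exact h.trans hερ
  have hh₂ : ‖h₂‖ ≤ ρ := by
    have h := (htu₂ 0 (Nat.zero_le _)).1
    rw [pow_zero, mul_one, hx₂] at h
    exact h.trans hερ
  have hd : ‖h₁ - h₂‖ ≤ 2 * mp / (1 - κ) := norm_initial_sub_le_of_isTunedQ hQ hT hη hη1 hα hβ hκ₁ hκ₂ hκ hε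
    hεr hερ ha0 hb0 hl0 hmp ha hb hl hm hmp' hsmall htr₁ htu₁ hx₁ htr₂ htu₂ hx₂
  have hD := (dist_traj_le_of_isTunedQ_initial hQ hQc hT hη hη1 hα hβ hκ₁ hκ₂ hκ hε hεr hερ ha0 hb0 hl0
    hmp ha hb hl hm hmp' hsmall htr₁ htu₁ hx₁ htr₂ htu₂ hx₂ N le_rfl).2
  have hεηr : ε * η ^ N ≤ r := by
    have : η ^ N ≤ 1 := pow_le_one₀ hη.le hη1
    nlinarith
  refine ⟨hd, ?_⟩
  exact norm_lastScale_sub_le (Q := Q) hΦ1 hΦ2 hlI (mul_nonneg hε (pow_nonneg hη.le N)) hεηr hh₁ hh₂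
    (htu₁ N le_rfl).2 (htu₂ N le_rfl).2 hd hD

end twoSystems

/-! ## §19 Four systems: the six difference sizes of the free-energy representation -/

section fourSystems

variable {N : ℕ} {r α β σ η κ ε ρ a₀ b₀ l₀ m₀ a₀₀ b₀₀ l₀₀ l₀' σ₂ m₀₀ μ₁ μ₂ δ₁ δ₂ cI lI lI' lII : ℝ}
  {Q : ∀ k, F k → ℝ → Prop}
  {A : E 0 → ∀ k, E k ≃L[ℝ] E (k + 1)} {B : E 0 → ∀ k, F k →+ E (k + 1)}
  {S : E 0 → ∀ k, E k → F k → F (k + 1)} {y₀ : Bool → Bool → E 0 → F 0}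
  {Φ : E 0 → F N → V} {h : Bool → Bool → E 0} {x : Bool → Bool → ∀ k, E k}

/-- **The six difference sizes of the free-energy representation over four fixed points of
Lemma 12.6** ([ABKM19] Theorem 2.2, `ℓ ≤ 2`, difference form): in the setting of
`secondDiff_initial_le_of_isTunedQ` (four systems indexed by `Bool × Bool`), with a last-scale functional
`Φ` satisfying the four difference-form hypotheses of `norm_secondDiff_lastScale_le` (`c_I`, `l_I`,
`l_I'`, `l_II`), writing `T_i = 2μ_i/(1−κ)`, `T₁₂ = 2·Rest/(1−κ)` and `I_{ij} = Φ(h_{ij}, K_N^{ij})`: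
`‖h_{1j} − h_{0j}‖ ≤ T₁`, `‖h_{i1} − h_{i0}‖ ≤ T₂`, `‖Σ± h‖ ≤ T₁₂`,
`‖I_{1j} − I_{0j}‖ ≤ (c_I + l_Iε)T₁η^N`, `‖I_{i1} − I_{i0}‖ ≤ (c_I + l_Iε)T₂η^N`,
`‖Σ± I‖ ≤ (c_I T₁₂ + 2 l_I' T₁T₂ + (l_I T₁₂ + l_II T₁T₂)ε)η^N`.
[cite: AdamsBuchholzKoteckyMuller2019, Lemma 12.6, Theorem 12.1, Theorem 2.2, Ch. 4 (4.12)] -/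
theorem freeEnergySizes_of_isTunedQ (hQ : IsSubaddNormBound Q)
    (hQc : ∀ k (y : F k) (c : ℝ), (∀ c', c < c' → Q k y c') → Q k y c)
    (hQnn : ∀ k (y : F k) (c : ℝ), Q k y c → 0 ≤ c)
    (hT : ∀ h₀ : E 0, ‖h₀‖ ≤ ρ → IsRGStepQ N r α β σ Q (A h₀) (B h₀) (S h₀))
    (hη : 0 < η) (hη1 : η ≤ 1) (hα : 0 ≤ α) (hβ : 0 ≤ β) (hκ₁ : α * (η + β) ≤ κ) (hκ₂ : σ ≤ κ * η)
    (hκ : κ < 1) (hε : 0 ≤ ε) (hεr : 3 * ε ≤ r) (hερ : 3 * ε ≤ ρ)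
    (ha0 : 0 ≤ a₀) (hb0 : 0 ≤ b₀) (hl0 : 0 ≤ l₀) (hm0 : 0 ≤ m₀) (ha00 : 0 ≤ a₀₀) (hb00 : 0 ≤ b₀₀)
    (hl00 : 0 ≤ l₀₀) (hl0' : 0 ≤ l₀') (hσ₂0 : 0 ≤ σ₂) (hm00 : 0 ≤ m₀₀) (hμ₁ : 0 ≤ μ₁) (hμ₂ : 0 ≤ μ₂)
    (hδ₁ : 0 ≤ δ₁) (hδ₂ : 0 ≤ δ₂)
    (ha : ∀ h₀ h₀' : E 0, ‖h₀‖ ≤ ρ → ‖h₀'‖ ≤ ρ → ∀ k, k < N → ∀ w : E (k + 1),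
      ‖(A h₀ k).symm w - (A h₀' k).symm w‖ ≤ a₀ * ‖h₀ - h₀'‖ * ‖w‖)
    (hb : ∀ h₀ h₀' : E 0, ‖h₀‖ ≤ ρ → ‖h₀'‖ ≤ ρ → ∀ k, k < N → ∀ (v : F k) (c : ℝ), Q k v c →
      ‖B h₀ k v - B h₀' k v‖ ≤ b₀ * ‖h₀ - h₀'‖ * c)
    (hl : ∀ h₀ h₀' : E 0, ‖h₀‖ ≤ ρ → ‖h₀'‖ ≤ ρ → ∀ k, k < N → ∀ (u : E k) (v : F k) (c : ℝ),
      ‖u‖ ≤ r → Q k v c → c ≤ r →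
        Q (k + 1) (S h₀ k u v - S h₀' k u v) (l₀ * ‖h₀ - h₀'‖ * max ‖u‖ c))
    (hA2 : ∀ h₀ y z : E 0, ‖h₀‖ ≤ ρ → ‖h₀ + y‖ ≤ ρ → ‖h₀ + z‖ ≤ ρ → ‖h₀ + y + z‖ ≤ ρ →
      ∀ k, k < N → ∀ w : E (k + 1),
        ‖(A (h₀ + y + z) k).symm w - (A (h₀ + y) k).symm w - (A (h₀ + z) k).symm w + (A h₀ k).symm w‖
          ≤ a₀₀ * ‖y‖ * ‖z‖ * ‖w‖)
    (hB2 : ∀ h₀ y z : E 0, ‖h₀‖ ≤ ρ → ‖h₀ + y‖ ≤ ρ → ‖h₀ + z‖ ≤ ρ → ‖h₀ + y + z‖ ≤ ρ →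
      ∀ k, k < N → ∀ (v : F k) (c : ℝ), Q k v c →
        ‖B (h₀ + y + z) k v - B (h₀ + y) k v - B (h₀ + z) k v + B h₀ k v‖ ≤ b₀₀ * ‖y‖ * ‖z‖ * c)
    (hS2 : ∀ h₀ y z : E 0, ‖h₀‖ ≤ ρ → ‖h₀ + y‖ ≤ ρ → ‖h₀ + z‖ ≤ ρ → ‖h₀ + y + z‖ ≤ ρ →
      ∀ k, k < N → ∀ (u : E k) (v : F k) (c : ℝ), ‖u‖ ≤ r → Q k v c → c ≤ r →
        Q (k + 1) (S (h₀ + y + z) k u v - S (h₀ + y) k u v - S (h₀ + z) k u v + S h₀ k u v)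
          (l₀₀ * ‖y‖ * ‖z‖ * max ‖u‖ c))
    (hl' : ∀ h₀ h₀' : E 0, ‖h₀‖ ≤ ρ → ‖h₀'‖ ≤ ρ → ∀ k, k < N →
      ∀ (u u' : E k) (v v' : F k) (cv cv' c : ℝ), ‖u‖ ≤ r → ‖u'‖ ≤ r →
        Q k v cv → cv ≤ r → Q k v' cv' → cv' ≤ r → Q k (v - v') c →
        Q (k + 1) ((S h₀' k u v - S h₀ k u v) - (S h₀' k u' v' - S h₀ k u' v'))
          (l₀' * ‖h₀' - h₀‖ * max ‖u - u'‖ c))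
    (hσ2 : ∀ h₀ : E 0, ‖h₀‖ ≤ ρ → ∀ k, k < N →
      ∀ (u y z : E k) (v y' z' : F k) (cv cvy cvz cvyz cy cz : ℝ),
        ‖u‖ ≤ r → ‖u + y‖ ≤ r → ‖u + z‖ ≤ r → ‖u + y + z‖ ≤ r →
        Q k v cv → cv ≤ r → Q k (v + y') cvy → cvy ≤ r → Q k (v + z') cvz → cvz ≤ r →
        Q k (v + y' + z') cvyz → cvyz ≤ r → Q k y' cy → Q k z' cz →
        Q (k + 1) (S h₀ k (u + y + z) (v + y' + z') - S h₀ k (u + y) (v + y')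
            - S h₀ k (u + z) (v + z') + S h₀ k u v) (σ₂ * max ‖y‖ cy * max ‖z‖ cz))
    (hm : ∀ i j, ∀ h₀ h₀' : E 0, ‖h₀‖ ≤ ρ → ‖h₀'‖ ≤ ρ →
      Q 0 (y₀ i j h₀ - y₀ i j h₀') (m₀ * ‖h₀ - h₀'‖))
    (hμ1 : ∀ j, ∀ h₀ : E 0, ‖h₀‖ ≤ ρ → Q 0 (y₀ true j h₀ - y₀ false j h₀) μ₁)
    (hμ2 : ∀ i, ∀ h₀ : E 0, ‖h₀‖ ≤ ρ → Q 0 (y₀ i true h₀ - y₀ i false h₀) μ₂)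
    (hμ12 : ∀ h₀ y z : E 0, ‖h₀‖ ≤ ρ → ‖h₀ + y‖ ≤ ρ → ‖h₀ + z‖ ≤ ρ → ‖h₀ + y + z‖ ≤ ρ →
      Q 0 (y₀ true true (h₀ + y + z) - y₀ true false (h₀ + y) - y₀ false true (h₀ + z) + y₀ false false h₀)
        (m₀₀ * (δ₁ + ‖y‖) * (δ₂ + ‖z‖)))
    (hsmall : max m₀ (max (l₀ * ε / η) ((α * b₀ + a₀ * (η + β + 2 * ρ * b₀)) * ε)) ≤ (1 - κ) / 2)
    (hΦ1 : ∀ h₀ : E 0, ‖h₀‖ ≤ ρ → ∀ (y y' : F N) (cy cy' c : ℝ), Q N y cy → cy ≤ r → Q N y' cy' →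
      cy' ≤ r → Q N (y - y') c → ‖Φ h₀ y - Φ h₀ y'‖ ≤ cI * c)
    (hΦ4 : ∀ h₀ : E 0, ‖h₀‖ ≤ ρ → ∀ (y₁₁ y₁₀ y₀₁ y₀₀ : F N) (c₁₁ c₁₀ c₀₁ c₀₀ c : ℝ),
      Q N y₁₁ c₁₁ → c₁₁ ≤ r → Q N y₁₀ c₁₀ → c₁₀ ≤ r → Q N y₀₁ c₀₁ → c₀₁ ≤ r → Q N y₀₀ c₀₀ → c₀₀ ≤ r →
      Q N (y₁₁ - y₁₀ - y₀₁ + y₀₀) c →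
        ‖Φ h₀ y₁₁ - Φ h₀ y₁₀ - Φ h₀ y₀₁ + Φ h₀ y₀₀‖ ≤ cI * c)
    (hΦ2 : ∀ h₀ h₀' : E 0, ‖h₀‖ ≤ ρ → ‖h₀'‖ ≤ ρ → ∀ (y : F N) (c : ℝ), Q N y c → c ≤ r →
      ‖Φ h₀ y - Φ h₀' y‖ ≤ lI * ‖h₀ - h₀'‖ * c)
    (hΦ12 : ∀ h₀ h₀' : E 0, ‖h₀‖ ≤ ρ → ‖h₀'‖ ≤ ρ → ∀ (y y' : F N) (cy cy' c : ℝ), Q N y cy → cy ≤ r →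
      Q N y' cy' → cy' ≤ r → Q N (y - y') c →
        ‖(Φ h₀ y - Φ h₀' y) - (Φ h₀ y' - Φ h₀' y')‖ ≤ lI' * ‖h₀ - h₀'‖ * c)
    (hΦ22 : ∀ h₀ u v : E 0, ‖h₀‖ ≤ ρ → ‖h₀ + u‖ ≤ ρ → ‖h₀ + v‖ ≤ ρ → ‖h₀ + u + v‖ ≤ ρ →
      ∀ (y : F N) (c : ℝ), Q N y c → c ≤ r →
        ‖Φ (h₀ + u + v) y - Φ (h₀ + u) y - Φ (h₀ + v) y + Φ h₀ y‖ ≤ lII * ‖u‖ * ‖v‖ * c)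
    (hlI : 0 ≤ lI) (hlI' : 0 ≤ lI') (hlII : 0 ≤ lII)
    (htr : ∀ i j, IsTunedQ N (A (h i j)) (B (h i j)) (S (h i j)) (y₀ i j (h i j)) (x i j))
    (htu : ∀ i j, InTubeQ N η ε Q (S (h i j)) (y₀ i j (h i j)) (x i j))
    (hx : ∀ i j, x i j 0 = h i j) :
    (∀ j, ‖h true j - h false j‖ ≤ 2 * μ₁ / (1 - κ)) ∧
    (∀ i, ‖h i true - h i false‖ ≤ 2 * μ₂ / (1 - κ)) ∧
    ‖h true true - h true false - h false true + h false false‖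
        ≤ 2 * secondPertSize α β η ε σ₂ (a₀ * (2 * μ₁ / (1 - κ))) (a₀ * (2 * μ₂ / (1 - κ)))
            (a₀₀ * (2 * μ₁ / (1 - κ)) * (2 * μ₂ / (1 - κ))) (b₀ * (2 * μ₁ / (1 - κ))) (b₀ * (2 * μ₂ / (1 - κ)))
            (b₀₀ * (2 * μ₁ / (1 - κ)) * (2 * μ₂ / (1 - κ))) (l₀' * (2 * μ₁ / (1 - κ))) (l₀' * (2 * μ₂ / (1 - κ)))
            (l₀₀ * (2 * μ₁ / (1 - κ)) * (2 * μ₂ / (1 - κ)))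
            (m₀₀ * (δ₁ + 2 * μ₁ / (1 - κ)) * (δ₂ + 2 * μ₂ / (1 - κ))) (2 * μ₁ / (1 - κ)) (2 * μ₂ / (1 - κ))
          / (1 - κ) ∧
    (∀ j, ‖Φ (h true j) (fwd (S (h true j)) (y₀ true j (h true j)) (x true j) N)
        - Φ (h false j) (fwd (S (h false j)) (y₀ false j (h false j)) (x false j) N)‖
          ≤ (cI + lI * ε) * (2 * μ₁ / (1 - κ)) * η ^ N) ∧
    (∀ i, ‖Φ (h i true) (fwd (S (h i true)) (y₀ i true (h i true)) (x i true) N)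
        - Φ (h i false) (fwd (S (h i false)) (y₀ i false (h i false)) (x i false) N)‖
          ≤ (cI + lI * ε) * (2 * μ₂ / (1 - κ)) * η ^ N) ∧
    ‖Φ (h true true) (fwd (S (h true true)) (y₀ true true (h true true)) (x true true) N)
        - Φ (h true false) (fwd (S (h true false)) (y₀ true false (h true false)) (x true false) N)
        - Φ (h false true) (fwd (S (h false true)) (y₀ false true (h false true)) (x false true) N)
        + Φ (h false false) (fwd (S (h false false)) (y₀ false false (h false false)) (x false false) N)‖
      ≤ (cI * (2 * secondPertSize α β η ε σ₂ (a₀ * (2 * μ₁ / (1 - κ))) (a₀ * (2 * μ₂ / (1 - κ)))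
            (a₀₀ * (2 * μ₁ / (1 - κ)) * (2 * μ₂ / (1 - κ))) (b₀ * (2 * μ₁ / (1 - κ))) (b₀ * (2 * μ₂ / (1 - κ)))
            (b₀₀ * (2 * μ₁ / (1 - κ)) * (2 * μ₂ / (1 - κ))) (l₀' * (2 * μ₁ / (1 - κ))) (l₀' * (2 * μ₂ / (1 - κ)))
            (l₀₀ * (2 * μ₁ / (1 - κ)) * (2 * μ₂ / (1 - κ)))
            (m₀₀ * (δ₁ + 2 * μ₁ / (1 - κ)) * (δ₂ + 2 * μ₂ / (1 - κ))) (2 * μ₁ / (1 - κ)) (2 * μ₂ / (1 - κ))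
          / (1 - κ))
        + 2 * lI' * (2 * μ₁ / (1 - κ)) * (2 * μ₂ / (1 - κ))
        + (lI * (2 * secondPertSize α β η ε σ₂ (a₀ * (2 * μ₁ / (1 - κ))) (a₀ * (2 * μ₂ / (1 - κ)))
            (a₀₀ * (2 * μ₁ / (1 - κ)) * (2 * μ₂ / (1 - κ))) (b₀ * (2 * μ₁ / (1 - κ))) (b₀ * (2 * μ₂ / (1 - κ)))
            (b₀₀ * (2 * μ₁ / (1 - κ)) * (2 * μ₂ / (1 - κ))) (l₀' * (2 * μ₁ / (1 - κ))) (l₀' * (2 * μ₂ / (1 - κ)))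
            (l₀₀ * (2 * μ₁ / (1 - κ)) * (2 * μ₂ / (1 - κ)))
            (m₀₀ * (δ₁ + 2 * μ₁ / (1 - κ)) * (δ₂ + 2 * μ₂ / (1 - κ))) (2 * μ₁ / (1 - κ)) (2 * μ₂ / (1 - κ))
          / (1 - κ))
          + lII * (2 * μ₁ / (1 - κ)) * (2 * μ₂ / (1 - κ))) * ε) * η ^ N := by
  have h1κ : 0 < 1 - κ := by linarith
  have hερ' : ε ≤ ρ := by linarith
  have hεr' : ε ≤ r := by linarith
  -- the fixed points lie in the `ε`-ball
  have hhε : ∀ i j, ‖h i j‖ ≤ ε := fun i j => by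
    have h0 := (htu i j 0 (Nat.zero_le _)).1
    rw [pow_zero, mul_one, hx i j] at h0
    exact h0
  set T₁ := 2 * μ₁ / (1 - κ) with hT₁
  set T₂ := 2 * μ₂ / (1 - κ) with hT₂
  have hT₁0 : 0 ≤ T₁ := div_nonneg (by linarith) h1κ.le
  have hT₂0 : 0 ≤ T₂ := div_nonneg (by linarith) h1κ.le
  -- first differences (§13, §18)
  have hd₁ : ∀ j, ‖h true j - h false j‖ ≤ T₁ ∧
      ‖Φ (h true j) (fwd (S (h true j)) (y₀ true j (h true j)) (x true j) N)
        - Φ (h false j) (fwd (S (h false j)) (y₀ false j (h false j)) (x false j) N)‖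
          ≤ (cI + lI * ε) * T₁ * η ^ N := fun j =>
    lastScale_sub_le_of_isTunedQ (y₀ := y₀ true j) (y₀' := y₀ false j) (Φ := Φ) hQ hQc hT hη hη1 hα hβ
      hκ₁ hκ₂ hκ hε hεr' hερ' ha0 hb0 hl0 hμ₁ ha hb hl (hm true j) (hμ1 j) hsmall hΦ1 hΦ2 hlI (htr true j)
      (htu true j) (hx true j) (htr false j) (htu false j) (hx false j)
  have hd₂ : ∀ i, ‖h i true - h i false‖ ≤ T₂ ∧
      ‖Φ (h i true) (fwd (S (h i true)) (y₀ i true (h i true)) (x i true) N)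
        - Φ (h i false) (fwd (S (h i false)) (y₀ i false (h i false)) (x i false) N)‖
          ≤ (cI + lI * ε) * T₂ * η ^ N := fun i =>
    lastScale_sub_le_of_isTunedQ (y₀ := y₀ i true) (y₀' := y₀ i false) (Φ := Φ) hQ hQc hT hη hη1 hα hβ
      hκ₁ hκ₂ hκ hε hεr' hερ' ha0 hb0 hl0 hμ₂ ha hb hl (hm i true) (hμ2 i) hsmall hΦ1 hΦ2 hlI (htr i true)
      (htu i true) (hx i true) (htr i false) (htu i false) (hx i false)
  -- first differences of the trajectories (§13)
  have hD₁ : ∀ j, Q N (fwd (S (h true j)) (y₀ true j (h true j)) (x true j) N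
        - fwd (S (h false j)) (y₀ false j (h false j)) (x false j) N) (T₁ * η ^ N) := fun j =>
    (dist_traj_le_of_isTunedQ_initial (y₀ := y₀ true j) (y₀' := y₀ false j) hQ hQc hT hη hη1 hα hβ hκ₁ hκ₂
      hκ hε hεr' hερ' ha0 hb0 hl0 hμ₁ ha hb hl (hm true j) (hμ1 j) hsmall (htr true j) (htu true j)
      (hx true j) (htr false j) (htu false j) (hx false j) N le_rfl).2
  have hD₂ : ∀ i, Q N (fwd (S (h i true)) (y₀ i true (h i true)) (x i true) N
        - fwd (S (h i false)) (y₀ i false (h i false)) (x i false) N) (T₂ * η ^ N) := fun i =>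
    (dist_traj_le_of_isTunedQ_initial (y₀ := y₀ i true) (y₀' := y₀ i false) hQ hQc hT hη hη1 hα hβ hκ₁ hκ₂
      hκ hε hεr' hερ' ha0 hb0 hl0 hμ₂ ha hb hl (hm i true) (hμ2 i) hsmall (htr i true) (htu i true)
      (hx i true) (htr i false) (htu i false) (hx i false) N le_rfl).2
  -- second differences (§15)
  have h2 := secondDiff_initial_le_of_isTunedQ hQ hQc hQnn hT hη hη1 hα hβ hκ₁ hκ₂ hκ hε hεr hερ ha0 hb0 hl0 hm0
    ha00 hb00 hl00 hl0' hσ₂0 hm00 hμ₁ hμ₂ hδ₁ hδ₂ ha hb hl hA2 hB2 hS2 hl' hσ2 hm hμ1 hμ2 hμ12 hsmall htr htu hx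
  obtain ⟨hd₁₂, htraj⟩ := h2
  obtain ⟨-, hD₁₂⟩ := htraj N le_rfl
  have hεηr : ε * η ^ N ≤ r := by
    have : η ^ N ≤ 1 := pow_le_one₀ hη.le hη1
    nlinarith
  refine ⟨fun j => (hd₁ j).1, fun i => (hd₂ i).1, hd₁₂, fun j => (hd₁ j).2, fun i => (hd₂ i).2, ?_⟩
  exact norm_secondDiff_lastScale_le (Q := Q) (Φ := Φ)
    (y := fun i j => fwd (S (h i j)) (y₀ i j (h i j)) (x i j) N) hΦ4 hΦ2 hΦ12 hΦ22 hlI hlI' hlII hT₁0 hT₂0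
    hη.le hερ hεηr hhε (fun i j => (htu i j N le_rfl).2) (fun j => (hd₁ j).1) (fun i => (hd₂ i).1) hd₁₂
    hD₁ hD₂ hD₁₂

end fourSystems

end RGFlow

end Literature.Dynamics.Hyperbolic

end
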